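import Summits.AtomisticToContinuum.Crystallization.Theorems.OverbindingBudgetAffineRunCutWord

/-!
# «RunCut», word level: the EXCHANGED BILAYERS of the TRIPLE and of the SWAP are exactly THREE per column

Support file (lens-4 g87, hand-in 3; memo `g87/memo/SW-CHI.md` §1 — settles critic row 1555 «count 3 vs 6»).  In the Hägg coding
`s : ℤ → ℤ` (`s i = ±1` the Shockley class of the translation between layers `i` and `i+1`) the TRIPLE reverses the steps `j−2, j, j+1`
(`…RunCutWord.tripleFlip`: layers `j−1, j` moved by one class, layer `j+1` by the other) and the SWAP the steps `j−1, j, j+1`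
(`…RunCutWord.swapFlip`).  An ADJACENT pair of layers `(i, i+1)` has its stacking class exchanged iff its step is reversed; hence per column
EXACTLY THREE bilayers are exchanged (★ `tripleFlip_exchanged_eq`, `card = 3`; the pair `(j−1, j)` of the TRIPLE moves rigidly) — not six.
The ideal Barlow energy `E_K` is blind to these exchanges (`delta_one_eq_zero`: a single step is never `≡ 0 (mod 3)`), so their entire cost is
the STRAIN-induced class-exchange energy `D(C)` of `…RunCutChiralityLink`, charged ★ `abs_sum_exchanged_le`: for any per-step cost `D` with
`|D i| ≤ B` on the column window, `|Σ_{i ∈ I, step i reversed} D i| ≤ 3·B` (TRIPLE and SWAP).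
[this file: 0 definitions, 9 theorems; imports `…RunCutWord`; standard axioms]
-/

namespace Summit.AtomisticToContinuum.Crystallization.Theorems.OverbindingBudgetAffineRunCutWordCount

open Finset
open Literature.MathematicalPhysics.StatisticalMechanics
open Summit.AtomisticToContinuum.Crystallization.Theorems.OverbindingBudgetAffineRunCutWord

variable {s : ℤ → ℤ}

/-! ## §1. Which steps the two slips reverse -/

/-- The TRIPLE reverses exactly the steps `j − 2`, `j`, `j + 1` of a Hägg word. [this file · kind: proof] -/
theorem tripleFlip_ne_iff (hs : IsHaggSeq s) (j i : ℤ) : tripleFlip j s i ≠ s i ↔ (i = j - 2 ∨ i = j ∨ i = j + 1) := by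
  simp only [tripleFlip]
  rcases hs i with h | h <;> split_ifs with hc <;> constructor <;> intro h' <;> omega

/-- The SWAP reverses exactly the steps `j − 1`, `j`, `j + 1` of a Hägg word. [this file · kind: proof] -/
theorem swapFlip_ne_iff (hs : IsHaggSeq s) (j i : ℤ) : swapFlip j s i ≠ s i ↔ (i = j - 1 ∨ i = j ∨ i = j + 1) := by
  simp only [swapFlip]
  rcases hs i with h | h <;> split_ifs with hc <;> constructor <;> intro h' <;> omega

/-! ## §2. ★ Exactly three exchanged bilayers per column -/

/-- ★ **TRIPLE: the exchanged adjacent pairs in any column window containing `j−2, j, j+1` are exactly `{j−2, j, j+1}`.**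
[this file · kind: proof] -/
theorem tripleFlip_exchanged_eq (hs : IsHaggSeq s) (j : ℤ) (I : Finset ℤ) (hI : ({j - 2, j, j + 1} : Finset ℤ) ⊆ I) :
    I.filter (fun i => tripleFlip j s i ≠ s i) = {j - 2, j, j + 1} := by
  ext i
  simp only [mem_filter, tripleFlip_ne_iff hs, mem_insert, mem_singleton]
  constructor
  · exact fun h => h.2
  · intro h
    refine ⟨hI ?_, h⟩
    simp only [mem_insert, mem_singleton]
    exact h

/-- ★ **SWAP: the exchanged adjacent pairs are exactly `{j−1, j, j+1}`.** [this file · kind: proof] -/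
theorem swapFlip_exchanged_eq (hs : IsHaggSeq s) (j : ℤ) (I : Finset ℤ) (hI : ({j - 1, j, j + 1} : Finset ℤ) ⊆ I) :
    I.filter (fun i => swapFlip j s i ≠ s i) = {j - 1, j, j + 1} := by
  ext i
  simp only [mem_filter, swapFlip_ne_iff hs, mem_insert, mem_singleton]
  constructor
  · exact fun h => h.2
  · intro h
    refine ⟨hI ?_, h⟩
    simp only [mem_insert, mem_singleton]
    exact h

/-- ★ **The count is THREE** (TRIPLE), in any column window containing the three steps; `≤ 3` in any window. [this file · kind: proof] -/
theorem card_tripleFlip_exchanged (hs : IsHaggSeq s) (j : ℤ) (I : Finset ℤ) :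
    (I.filter (fun i => tripleFlip j s i ≠ s i)).card ≤ 3
      ∧ (({j - 2, j, j + 1} : Finset ℤ) ⊆ I → (I.filter (fun i => tripleFlip j s i ≠ s i)).card = 3) := by
  have h3 : ({j - 2, j, j + 1} : Finset ℤ).card = 3 :=
    card_eq_three.2 ⟨j - 2, j, j + 1, by omega, by omega, by omega, rfl⟩
  have hsub : I.filter (fun i => tripleFlip j s i ≠ s i) ⊆ ({j - 2, j, j + 1} : Finset ℤ) := by
    intro i hi
    rw [mem_filter, tripleFlip_ne_iff hs] at hi
    simp only [mem_insert, mem_singleton]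
    exact hi.2
  exact ⟨(card_le_card hsub).trans h3.le, fun hI => by rw [tripleFlip_exchanged_eq hs j I hI, h3]⟩

/-- ★ **The count is THREE** (SWAP). [this file · kind: proof] -/
theorem card_swapFlip_exchanged (hs : IsHaggSeq s) (j : ℤ) (I : Finset ℤ) :
    (I.filter (fun i => swapFlip j s i ≠ s i)).card ≤ 3
      ∧ (({j - 1, j, j + 1} : Finset ℤ) ⊆ I → (I.filter (fun i => swapFlip j s i ≠ s i)).card = 3) := by
  have h3 : ({j - 1, j, j + 1} : Finset ℤ).card = 3 :=
    card_eq_three.2 ⟨j - 1, j, j + 1, by omega, by omega, by omega, rfl⟩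
  have hsub : I.filter (fun i => swapFlip j s i ≠ s i) ⊆ ({j - 1, j, j + 1} : Finset ℤ) := by
    intro i hi
    rw [mem_filter, swapFlip_ne_iff hs] at hi
    simp only [mem_insert, mem_singleton]
    exact hi.2
  exact ⟨(card_le_card hsub).trans h3.le, fun hI => by rw [swapFlip_exchanged_eq hs j I hI, h3]⟩

/-! ## §3. The ideal stacking energy is blind to the exchanges; the exchange line of a column -/

/-- **`E_K` is blind at distance `1`**: a single Hägg step is never `≡ 0 (mod 3)`, so the `k = 1` alignment terms of the word and of the
slipped word both vanish (`…RunCutWord.delta … 1 = 0`). [this file · kind: proof] -/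
theorem delta_one_eq_zero (hs : IsHaggSeq s) (J : ℕ → ℝ) (j m : ℤ) : delta J j s m 1 = 0 := by
  have hs' := isHaggSeq_tripleFlip hs j
  have h1 : ¬ HaggAligned s m 1 := by
    rw [haggAligned_iff]
    simp only [range_one, sum_singleton, Nat.cast_zero, add_zero]
    rcases hs m with h | h <;> omega
  have h2 : ¬ HaggAligned (tripleFlip j s) m 1 := by
    rw [haggAligned_iff]
    simp only [range_one, sum_singleton, Nat.cast_zero, add_zero]
    rcases hs' m with h | h <;> omega
  simp only [delta, h1, h2, if_false, sub_zero]

/-- ★ **THE EXCHANGE LINE OF A COLUMN (TRIPLE)**: for any per-step exchange cost `D` with `|D i| ≤ B` (`0 ≤ B`) on the column window `I`,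
`|Σ_{i ∈ I, step i reversed} D i| ≤ 3·B`. [this file · kind: proof] -/
theorem abs_sum_exchanged_le (hs : IsHaggSeq s) (j : ℤ) (I : Finset ℤ) (D : ℤ → ℝ) {B : ℝ} (hB0 : 0 ≤ B)
    (hB : ∀ i ∈ I, |D i| ≤ B) :
    |∑ i ∈ I, (if tripleFlip j s i ≠ s i then D i else 0)| ≤ 3 * B := by
  rw [← sum_filter]
  have hc := (card_tripleFlip_exchanged hs j I).1
  calc |∑ i ∈ I.filter (fun i => tripleFlip j s i ≠ s i), D i|
      ≤ ∑ i ∈ I.filter (fun i => tripleFlip j s i ≠ s i), |D i| := abs_sum_le_sum_abs _ _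
    _ ≤ ∑ _i ∈ I.filter (fun i => tripleFlip j s i ≠ s i), B :=
        sum_le_sum fun i hi => hB i (mem_of_mem_filter i hi)
    _ = ((I.filter (fun i => tripleFlip j s i ≠ s i)).card : ℝ) * B := by rw [sum_const, nsmul_eq_mul]
    _ ≤ 3 * B := by
        have : ((I.filter (fun i => tripleFlip j s i ≠ s i)).card : ℝ) ≤ 3 := by exact_mod_cast hc
        nlinarith

/-- ★ **THE EXCHANGE LINE OF A COLUMN (SWAP)**: `|Σ_{i ∈ I, step i reversed} D i| ≤ 3·B`. [this file · kind: proof] -/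
theorem abs_sum_swap_exchanged_le (hs : IsHaggSeq s) (j : ℤ) (I : Finset ℤ) (D : ℤ → ℝ) {B : ℝ} (hB0 : 0 ≤ B)
    (hB : ∀ i ∈ I, |D i| ≤ B) :
    |∑ i ∈ I, (if swapFlip j s i ≠ s i then D i else 0)| ≤ 3 * B := by
  rw [← sum_filter]
  have hc := (card_swapFlip_exchanged hs j I).1
  calc |∑ i ∈ I.filter (fun i => swapFlip j s i ≠ s i), D i|
      ≤ ∑ i ∈ I.filter (fun i => swapFlip j s i ≠ s i), |D i| := abs_sum_le_sum_abs _ _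
    _ ≤ ∑ _i ∈ I.filter (fun i => swapFlip j s i ≠ s i), B :=
        sum_le_sum fun i hi => hB i (mem_of_mem_filter i hi)
    _ = ((I.filter (fun i => swapFlip j s i ≠ s i)).card : ℝ) * B := by rw [sum_const, nsmul_eq_mul]
    _ ≤ 3 * B := by
        have : ((I.filter (fun i => swapFlip j s i ≠ s i)).card : ℝ) ≤ 3 := by exact_mod_cast hc
        nlinarith

end Summit.AtomisticToContinuum.Crystallization.Theorems.OverbindingBudgetAffineRunCutWordCount
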